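import Summits.ABC.IUTFork.Repair.RHR4DiscriminatorOneSided
import HarnessLib

/-!
# ROUND-4 row R4PATH-E — the FLOOR face: the two κ₁ door laws have dilation `Λ ≥ 3/μ₀` (κ′ = 1) and `Λ ≥ 3/(2μ₀)` (κ′ = 3/2) at EVERY level

abc-iut cell, rung LADDER-ABC:A2.RESCUE.H; seat abc-iut-rh-kit-1 g8 (KEY R4PATH-E; memo `plan/rescue/R-H/ROUND4/R4-PATH-E-rh-kit-1.md`
§5, kit j283224 two engines). CURRENCY = abc-iut-reqb-typ-1's `RH.ReqsideWeightLaws` (`lawPow a`, `demandSum`) and abc-iut-rh2-xi-1's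
ONE-SIDEDNESS face `RH.R4Discriminator` (p538952: `Λ = D₄/(μ₀·D_a) ≥ 1/μ₀` for every κ-law `lawPow a`, `a ≤ 4`). This file SHARPENS
that family floor for the two typed κ₁ laws of the OPENINGS-CENSUS doors O-01…O-05 (`a = 2`: κ′ = 1; `a = 3`: κ′ = 3/2), with no
monotonicity-in-`l` argument: §1 the termwise integer lemma `3·⌈j^{3/2}⌉ ≤ 2j² + 1` (certificate `j³ ≤ s²` with `3s ≤ 2j²+1`);
§2 `3·D₃(n) ≤ 2·D₄(n)` and the closed form `3·D₂(n)·(2n+5) = … = 3·D₄(n)` ratio; §3 the dilation floors `3/(2μ₀) ≤ D₄/(μ₀·D₃)`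
and `D₄/(μ₀·D₂) = (2n+5)/(3μ₀) ≥ 3/μ₀` for `n = l⋆ ≥ 2`; §4 the five doors' exponent floors `E = 6Λ ≥ 128/3, 36, 24, 64/3, 18`
at every level, attained at `n = 2` (`l = 5`: `D₂ = 1`, `D₃ = 2`, `D₄ = 3`). Read with the memo: these floors say the census value
`E★ = 18` is the LEAST exponent any of the five doors hands downstream at ANY prime `l`; they do NOT say that a κ₁ object exists, that
`l = 5` is admissible in [IUTchIV] Thm 1.10's setting (it is not: `l ≠ 5` there), or anything about IUT or abc. HONEST FRAMING: a
«door» is a claim-tagged hypothesis in OUR typed cell currency; nothing asserts abc proved or refuted; no side on [IUTchIII] Cor. 3.12 /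
[IUTchIV] Thm. 1.10 or any author; typed ≠ proved; computed ≠ proved. [folklore] arithmetic throughout.
-/

noncomputable section

namespace Summit.ABC.IUTFork.Repair.RH.R4PathE

open Summit.ABC.IUTFork.Repair.RH.ReqsideWeightLaws
open Summit.ABC.IUTFork.Repair.RH.R4Discriminator

/-! ## §1. Termwise: `3·⌈j^{3/2}⌉ ≤ 2j² + 1` -/

/-- **`3·lawPow 3 j ≤ 2j² + 1`** for every label `j ≥ 1` (equality at `j = 1, 2`): certificate `s` with `3s ≤ 2j²+1` and `j³ ≤ s²`
(`j ≥ 3`: `s = ⌊(2j²+1)/3⌋ ≥ (2j²−1)/3` and `(2j²−1)² − 9j³ = 4j³(j−3) + 3j²(j−3) + 5j² + 1 ≥ 0`). [folklore] -/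
theorem three_mul_lawPow_three_le {j : ℕ} (hj : 1 ≤ j) : 3 * lawPow 3 j ≤ 2 * (j : ℤ) ^ 2 + 1 := by
  rcases Nat.lt_or_ge j 3 with hlt | hge
  · interval_cases j
    · rw [lawPow_at_one]; norm_num
    · rw [lawPow_three_two_three.1]; norm_num
  · obtain ⟨k, hk⟩ : ∃ k : ℕ, k = j ^ 2 := ⟨_, rfl⟩
    set s : ℕ := (2 * k + 1) / 3 with hs
    have h3s : 3 * s ≤ 2 * k + 1 := Nat.mul_div_le (2 * k + 1) 3
    have h3s' : 2 * k + 1 < 3 * s + 3 := by omega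
    have hk9 : 9 ≤ k := by rw [hk]; nlinarith
    have hjz : (3 : ℤ) ≤ (j : ℤ) := by exact_mod_cast hge
    have hkz : ((k : ℕ) : ℤ) = (j : ℤ) ^ 2 := by rw [hk]; push_cast; ring
    -- 9 j³ ≤ (2k − 1)² ≤ (3s)²  in ℤ
    have hA : 9 * (j : ℤ) ^ 3 ≤ (2 * (k : ℤ) - 1) ^ 2 := by
      rw [hkz]
      nlinarith [mul_nonneg (pow_nonneg (by linarith : (0 : ℤ) ≤ j) 3) (by linarith : (0 : ℤ) ≤ (j : ℤ) - 3),
        mul_nonneg (pow_nonneg (by linarith : (0 : ℤ) ≤ j) 2) (by linarith : (0 : ℤ) ≤ (j : ℤ) - 3),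
        pow_nonneg (by linarith : (0 : ℤ) ≤ j) 2]
    have hB1 : 2 * (k : ℤ) - 1 ≤ 3 * (s : ℤ) := by
      have := h3s'; omega
    have hB0 : (0 : ℤ) ≤ 2 * (k : ℤ) - 1 := by
      have := hk9; omega
    have hB : (2 * (k : ℤ) - 1) ^ 2 ≤ (3 * (s : ℤ)) ^ 2 := by nlinarith
    have hC : (j : ℤ) ^ 3 ≤ (s : ℤ) ^ 2 := by nlinarith
    have hC' : j ^ 3 ≤ s ^ 2 := by exact_mod_cast hC
    have hlaw : lawPow 3 j ≤ (s : ℤ) := lawPow_le_of_pow_le_sq hC'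
    have h3sz : 3 * (s : ℤ) ≤ 2 * (k : ℤ) + 1 := by exact_mod_cast h3s
    rw [← hkz]
    linarith

/-! ## §2. Sums: `3·D₃ ≤ 2·D₄` and `D₄ : D₂ = (2n+5) : 3` -/

/-- **`3·D_{3/2}(n) ≤ 2·D₂(n)`**: `3·demandSum (lawPow 3) 1 n ≤ 2·demandSum (lawPow 4) 1 n` for every `n` (sum of §1 over the labels;
equality at `n ≤ 2`). [folklore] -/
theorem three_mul_demandSum_three_le (n : ℕ) : 3 * demandSum (lawPow 3) 1 n ≤ 2 * demandSum (lawPow 4) 1 n := by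
  induction n with
  | zero => simp [demandSum]
  | succ n ih =>
    rw [demandSum_succ, demandSum_succ, lawPow_four]
    have h := three_mul_lawPow_three_le (j := n + 1) (by omega)
    push_cast at h ⊢
    nlinarith [h, ih]

/-- **`3·D₂(n) = 6·…`: the κ′ = 1 ratio in closed form** — `(2n+5)·(2·demandSum (lawPow 2) 1 n) = 6·demandSum (lawPow 4) 1 n`
(both sides `= n(n−1)(2n+5)`). [folklore] -/
theorem ratio_two_four (n : ℕ) :
    (2 * (n : ℤ) + 5) * (2 * demandSum (lawPow 2) 1 n) = 6 * demandSum (lawPow 4) 1 n := by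
  rw [two_mul_demandSum_lawPow_two,
    demandSum_congr (f := lawPow 4) (g := fun j => (j : ℤ) ^ 2) (fun j _ => lawPow_four j) 1 n, six_mul_demandSum_sq]
  ring

/-! ## §3. Dilation floors at every level `n = l⋆ ≥ 2` -/

/-- **κ′ = 3/2: `3/(2μ₀) ≤ Λ = D₄/(μ₀·D₃)`** for `0 < μ₀`, `n ≥ 2`. [folklore] -/
theorem floor_dilation_three {μ₀ : ℝ} (hμ : 0 < μ₀) {n : ℕ} (hn : 2 ≤ n) :
    3 / (2 * μ₀) ≤ ((demandSum (lawPow 4) 1 n : ℤ) : ℝ) / (μ₀ * (demandSum (lawPow 3) 1 n : ℤ)) := by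
  have hD3 : (0 : ℝ) < ((demandSum (lawPow 3) 1 n : ℤ) : ℝ) := by exact_mod_cast demandSum_lawPow_pos (by norm_num) hn
  have hle : (3 : ℝ) * ((demandSum (lawPow 3) 1 n : ℤ) : ℝ) ≤ 2 * ((demandSum (lawPow 4) 1 n : ℤ) : ℝ) := by
    exact_mod_cast three_mul_demandSum_three_le n
  rw [div_le_div_iff₀ (by positivity) (mul_pos hμ hD3)]
  nlinarith

/-- **κ′ = 1: `Λ = D₄/(μ₀·D₂) = (2n+5)/(3μ₀)`** for `μ₀ ≠ 0`, `n ≥ 2`. [folklore] -/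
theorem dilation_two_eq {μ₀ : ℝ} (hμ : μ₀ ≠ 0) {n : ℕ} (hn : 2 ≤ n) :
    ((demandSum (lawPow 4) 1 n : ℤ) : ℝ) / (μ₀ * (demandSum (lawPow 2) 1 n : ℤ)) = (2 * (n : ℝ) + 5) / (3 * μ₀) := by
  have hD2 : (0 : ℝ) < ((demandSum (lawPow 2) 1 n : ℤ) : ℝ) := by exact_mod_cast demandSum_lawPow_pos (le_refl 2) hn
  have hr : (2 * (n : ℝ) + 5) * (2 * ((demandSum (lawPow 2) 1 n : ℤ) : ℝ)) = 6 * ((demandSum (lawPow 4) 1 n : ℤ) : ℝ) := by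
    exact_mod_cast ratio_two_four n
  rw [div_eq_div_iff (mul_ne_zero hμ hD2.ne') (mul_ne_zero (by norm_num) hμ)]
  linear_combination (-(μ₀ / 2)) * hr

/-- **κ′ = 1: `3/μ₀ ≤ Λ`** for `0 < μ₀`, `n ≥ 2`. [folklore] -/
theorem floor_dilation_two {μ₀ : ℝ} (hμ : 0 < μ₀) {n : ℕ} (hn : 2 ≤ n) :
    3 / μ₀ ≤ ((demandSum (lawPow 4) 1 n : ℤ) : ℝ) / (μ₀ * (demandSum (lawPow 2) 1 n : ℤ)) := by
  rw [dilation_two_eq hμ.ne' hn, div_le_div_iff₀ hμ (by positivity)]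
  have hn' : (2 : ℝ) ≤ n := by exact_mod_cast hn
  nlinarith

/-! ## §4. The five doors' exponent floors `E = 6Λ` at every level, attained at `l = 5` -/

/-- Level `l = 5` (`n = 2`): `D₂(2) = 1`, `D₃(2) = 2`, `D₄(2) = 3`. [folklore] -/
theorem demandSum_values_two :
    demandSum (lawPow 2) 1 2 = 1 ∧ demandSum (lawPow 3) 1 2 = 2 ∧ demandSum (lawPow 4) 1 2 = 3 := by
  refine ⟨?_, ?_, ?_⟩
  · have h := two_mul_demandSum_lawPow_two 2; push_cast at h; omega
  · rw [demandSum_succ, demandSum_succ]; simp only [demandSum, Finset.range_zero, Finset.sum_empty]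
    rw [lawPow_at_one, lawPow_three_two_three.1]; norm_num
  · have h := six_mul_demandSum_sq 2
    rw [← demandSum_congr (f := lawPow 4) (g := fun j => (j : ℤ) ^ 2) (fun j _ => lawPow_four j) 1 2] at h
    push_cast at h; omega

/-- **DOOR FLOORS (O-01 … O-05) AT EVERY LEVEL `n = l⋆ ≥ 2`**: `6Λ ≥ 128/3` (κ′ = 1, μ₀ = 27/64) · `≥ 36` (1, ½) · `≥ 24` (1, ¾) ·
`≥ 64/3` (3/2, 27/64) · `≥ 18` (3/2, ½) — the census value `E★ = 18` is the least exponent of the five doors over ALL levels. [folklore] -/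
theorem door_exponent_floors {n : ℕ} (hn : 2 ≤ n) :
    128 / 3 ≤ 6 * (((demandSum (lawPow 4) 1 n : ℤ) : ℝ) / ((27 / 64 : ℝ) * (demandSum (lawPow 2) 1 n : ℤ))) ∧
    36 ≤ 6 * (((demandSum (lawPow 4) 1 n : ℤ) : ℝ) / ((1 / 2 : ℝ) * (demandSum (lawPow 2) 1 n : ℤ))) ∧
    24 ≤ 6 * (((demandSum (lawPow 4) 1 n : ℤ) : ℝ) / ((3 / 4 : ℝ) * (demandSum (lawPow 2) 1 n : ℤ))) ∧
    64 / 3 ≤ 6 * (((demandSum (lawPow 4) 1 n : ℤ) : ℝ) / ((27 / 64 : ℝ) * (demandSum (lawPow 3) 1 n : ℤ))) ∧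
    18 ≤ 6 * (((demandSum (lawPow 4) 1 n : ℤ) : ℝ) / ((1 / 2 : ℝ) * (demandSum (lawPow 3) 1 n : ℤ))) := by
  have h1 := floor_dilation_two (μ₀ := 27 / 64) (by norm_num) hn
  have h2 := floor_dilation_two (μ₀ := 1 / 2) (by norm_num) hn
  have h3 := floor_dilation_two (μ₀ := 3 / 4) (by norm_num) hn
  have h4 := floor_dilation_three (μ₀ := 27 / 64) (by norm_num) hn
  have h5 := floor_dilation_three (μ₀ := 1 / 2) (by norm_num) hn
  norm_num at h1 h2 h3 h4 h5 ⊢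
  exact ⟨by linarith, by linarith, by linarith, by linarith, by linarith⟩

/-- The floors are ATTAINED at `l = 5` (`n = 2`): `6Λ = 128/3, 36, 24, 64/3, 18`. [folklore] -/
theorem door_exponents_at_five :
    6 * (((demandSum (lawPow 4) 1 2 : ℤ) : ℝ) / ((27 / 64 : ℝ) * (demandSum (lawPow 2) 1 2 : ℤ))) = 128 / 3 ∧
    6 * (((demandSum (lawPow 4) 1 2 : ℤ) : ℝ) / ((1 / 2 : ℝ) * (demandSum (lawPow 2) 1 2 : ℤ))) = 36 ∧
    6 * (((demandSum (lawPow 4) 1 2 : ℤ) : ℝ) / ((3 / 4 : ℝ) * (demandSum (lawPow 2) 1 2 : ℤ))) = 24 ∧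
    6 * (((demandSum (lawPow 4) 1 2 : ℤ) : ℝ) / ((27 / 64 : ℝ) * (demandSum (lawPow 3) 1 2 : ℤ))) = 64 / 3 ∧
    6 * (((demandSum (lawPow 4) 1 2 : ℤ) : ℝ) / ((1 / 2 : ℝ) * (demandSum (lawPow 3) 1 2 : ℤ))) = 18 := by
  obtain ⟨h2, h3, h4⟩ := demandSum_values_two
  rw [h2, h3, h4]
  norm_num

/-- **NO PATH inside the family (abc-normalised exponent)**: for every κ-law `lawPow a` with `2 ≤ a ≤ 4`, credit `0 < μ₀ ≤ 3/4`, level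
`n ≥ 2` and any finite-`l` factor `1 ≤ φ` (print's `1 + 20·d_mod/l`), `Λ·φ ≥ 4/3 > 1` — the «1+ε» slot is out of reach. [folklore] -/
theorem abcnorm_ge_four_thirds {a n : ℕ} (ha2 : 2 ≤ a) (ha4 : a ≤ 4) (hn : 2 ≤ n) {μ₀ φ : ℝ} (hμ : 0 < μ₀) (hμ34 : μ₀ ≤ 3 / 4)
    (hφ : 1 ≤ φ) :
    4 / 3 ≤ ((demandSum (lawPow 4) 1 n : ℤ) : ℝ) / (μ₀ * (demandSum (lawPow a) 1 n : ℤ)) * φ := by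
  have hDa : (0 : ℝ) < ((demandSum (lawPow a) 1 n : ℤ) : ℝ) := by exact_mod_cast demandSum_lawPow_pos ha2 hn
  have hle : ((demandSum (lawPow a) 1 n : ℤ) : ℝ) ≤ ((demandSum (lawPow 4) 1 n : ℤ) : ℝ) := by
    exact_mod_cast demandSum_lawPow_le_four ha4 n
  have hΛ : 1 / μ₀ ≤ ((demandSum (lawPow 4) 1 n : ℤ) : ℝ) / (μ₀ * (demandSum (lawPow a) 1 n : ℤ)) := inv_le_dilation hμ hDa hle
  have h43 : 4 / 3 ≤ 1 / μ₀ := by rw [div_le_div_iff₀ (by norm_num) hμ]; linarith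
  have hΛpos : 0 ≤ ((demandSum (lawPow 4) 1 n : ℤ) : ℝ) / (μ₀ * (demandSum (lawPow a) 1 n : ℤ)) := le_trans (by positivity) hΛ
  nlinarith [mul_le_mul hΛ hφ (by norm_num) hΛpos]

end Summit.ABC.IUTFork.Repair.RH.R4PathE

end
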